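import Summits.AtomisticToContinuum.FouriersLaw.Theses.HonestZwanzig
import Literature.Barriers.AtomisticToContinuum.SpectralGapClosingEquilibrium
import Literature.MathematicalPhysics.KineticTheory.LangevinChainNESSProofs

/-!
# HonestZwanzig / OrthogonalOhm — bracket induction, part 1: finite differences of the generator (line `Sketch`, stub F3)

Support file for crux item `stmt-AtomisticToContinuum-12693` (`HonestZwanzig.OrthogonalOhm`), registered stub
`stub_bracketInduction` (F3) of skeleton v5 (the algebraic half of `G(0) ≻ 0`).  Pure calculus on
`PhaseSpace N`, any chain with differentiable potentials:

* invariance of a differentiable function along a coordinate line from the vanishing of the corresponding partial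
  derivative (`pLine_const`, `qLine_const`) and its propagation to all `partialQ`/`partialP`;
* `generator_pVar` — moving `p_x` changes `L v` by `(s − p_x) ∂_{q_x} v` when `v` ignores `p_x`;
* `generator_qVar` — moving `q_y` changes `L v` by `−(V'(q_{y+1} − t) − V'(q_{y+1} − q_y)) ∂_{p_{y+1}} v` when `v`
  ignores `q_y` and `∂_{p_i} v ≡ 0` for `i ≤ y`;
* `sum_e_pVar`, `sum_e_qVar` — the matching variations of an energy profile `Σ ξ_x e_x` (split site energies).
Part 2 (`…BracketInduction.lean`) runs the induction.
-/
noncomputable section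

open Function Finset
open Literature.MathematicalPhysics.KineticTheory.HeatConduction
open Literature.Barriers.AtomisticToContinuum

namespace Summit.AtomisticToContinuum.FouriersLaw.Theorems.HonestZwanzig

namespace OrthogonalOhmLine.BracketInduction

variable {N : ℕ}

/-! ### Invariance along a coordinate line and its propagation to partial derivatives -/

/-- A differentiable function with `∂_{p_i} f ≡ 0` is invariant along every `p_i`-line. -/
theorem pLine_const {f : PhaseSpace N → ℝ} (hf : Differentiable ℝ f) (i : Fin N)
    (h : ∀ z, partialP i f z = 0) (z : PhaseSpace N) (s : ℝ) : f (z.1, update z.2 i s) = f z := by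
  set g : ℝ → ℝ := fun t => f (z.1, update z.2 i t) with hg
  have hgd : Differentiable ℝ g := by
    intro t
    have h1 : DifferentiableAt ℝ (fun t : ℝ => (z.1, update z.2 i t)) t :=
      (differentiableAt_const _).prodMk (hasDerivAt_update z.2 i t).differentiableAt
    exact (hf _).comp t h1
  have hg0 : ∀ t, deriv g t = 0 := by
    intro t
    have := h (z.1, update z.2 i t)
    simp only [partialP, update_idem, update_self] at this
    exact this
  have hconst := is_const_of_deriv_eq_zero hgd hg0 s (z.2 i)
  simp only [hg, update_eq_self] at hconst
  exact hconst

/-- A differentiable function with `∂_{q_i} f ≡ 0` is invariant along every `q_i`-line. -/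
theorem qLine_const {f : PhaseSpace N → ℝ} (hf : Differentiable ℝ f) (i : Fin N)
    (h : ∀ z, partialQ i f z = 0) (z : PhaseSpace N) (s : ℝ) : f (update z.1 i s, z.2) = f z := by
  set g : ℝ → ℝ := fun t => f (update z.1 i t, z.2) with hg
  have hgd : Differentiable ℝ g := by
    intro t
    have h1 : DifferentiableAt ℝ (fun t : ℝ => (update z.1 i t, z.2)) t :=
      (hasDerivAt_update z.1 i t).differentiableAt.prodMk (differentiableAt_const _)
    exact (hf _).comp t h1
  have hg0 : ∀ t, deriv g t = 0 := by
    intro t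
    have := h (update z.1 i t, z.2)
    simp only [partialQ, update_idem, update_self] at this
    exact this
  have hconst := is_const_of_deriv_eq_zero hgd hg0 s (z.1 i)
  simp only [hg, update_eq_self] at hconst
  exact hconst

/-- `p_i`-invariance passes to every `∂_{q_j}`. -/
theorem partialQ_of_pInv {f : PhaseSpace N → ℝ} {i : Fin N} (h : ∀ z s, f (z.1, update z.2 i s) = f z)
    (j : Fin N) (z : PhaseSpace N) (s : ℝ) : partialQ j f (z.1, update z.2 i s) = partialQ j f z := by
  simp only [partialQ]
  congr 1
  funext t
  exact h (update z.1 j t, z.2) s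

/-- `p_i`-invariance passes to every `∂_{p_j}`. -/
theorem partialP_of_pInv {f : PhaseSpace N → ℝ} {i : Fin N} (h : ∀ z s, f (z.1, update z.2 i s) = f z)
    (j : Fin N) (z : PhaseSpace N) (s : ℝ) : partialP j f (z.1, update z.2 i s) = partialP j f z := by
  simp only [partialP]
  by_cases hji : j = i
  · subst hji
    simp only [update_idem, update_self]
    have h1 : (fun t => f (z.1, update z.2 j t)) = fun _ => f z := funext fun t => h z t
    rw [h1, deriv_const, deriv_const]
  · rw [update_of_ne hji]
    congr 1
    funext t
    rw [update_comm (Ne.symm hji)]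
    exact h (z.1, update z.2 j t) s

/-- `q_i`-invariance passes to every `∂_{p_j}`. -/
theorem partialP_of_qInv {f : PhaseSpace N → ℝ} {i : Fin N} (h : ∀ z s, f (update z.1 i s, z.2) = f z)
    (j : Fin N) (z : PhaseSpace N) (s : ℝ) : partialP j f (update z.1 i s, z.2) = partialP j f z := by
  simp only [partialP]
  congr 1
  funext t
  exact h (z.1, update z.2 j t) s

/-- `q_i`-invariance passes to every `∂_{q_j}`. -/
theorem partialQ_of_qInv {f : PhaseSpace N → ℝ} {i : Fin N} (h : ∀ z s, f (update z.1 i s, z.2) = f z)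
    (j : Fin N) (z : PhaseSpace N) (s : ℝ) : partialQ j f (update z.1 i s, z.2) = partialQ j f z := by
  simp only [partialQ]
  by_cases hji : j = i
  · subst hji
    simp only [update_idem, update_self]
    have h1 : (fun t => f (update z.1 j t, z.2)) = fun _ => f z := funext fun t => h z t
    rw [h1, deriv_const, deriv_const]
  · rw [update_of_ne hji]
    congr 1
    funext t
    rw [update_comm (Ne.symm hji)]
    exact h (update z.1 j t, z.2) s

/-- A `p_i`-invariant function has `∂_{p_i} f ≡ 0`. -/
theorem partialP_self_of_pInv {f : PhaseSpace N → ℝ} {i : Fin N} (h : ∀ z s, f (z.1, update z.2 i s) = f z)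
    (z : PhaseSpace N) : partialP i f z = 0 := by
  simp only [partialP]
  have h1 : (fun t => f (z.1, update z.2 i t)) = fun _ => f z := funext fun t => h z t
  rw [h1, deriv_const]

/-- A `q_i`-invariant function has `∂_{q_i} f ≡ 0`. -/
theorem partialQ_self_of_qInv {f : PhaseSpace N → ℝ} {i : Fin N} (h : ∀ z s, f (update z.1 i s, z.2) = f z)
    (z : PhaseSpace N) : partialQ i f z = 0 := by
  simp only [partialQ]
  have h1 : (fun t => f (update z.1 i t, z.2)) = fun _ => f z := funext fun t => h z t
  rw [h1, deriv_const]

/-- `∂_{q_i} H` does not depend on the momenta (differentiable potentials). -/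
theorem partialQ_hamiltonian_indep_p (P : OscillatorChain) (hU : Differentiable ℝ P.U)
    (hV : Differentiable ℝ P.V) (i : Fin N) (q p p' : Fin N → ℝ) :
    partialQ i (P.hamiltonian N) (q, p') = partialQ i (P.hamiltonian N) (q, p) := by
  rw [partialQ_hamiltonian P hU hV i (q, p'), partialQ_hamiltonian P hU hV i (q, p)]

/-! ### Finite-difference identities for the generator -/

/-- Replacing one momentum in the transport sum. -/
theorem sum_update_mul (p : Fin N → ℝ) (x : Fin N) (s : ℝ) (A B : Fin N → ℝ) :
    (∑ i, (update p x s i * A i - B i)) = (∑ i, (p i * A i - B i)) + (s - p x) * A x := by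
  have h : ∀ i ∈ (univ : Finset (Fin N)),
      update p x s i * A i - B i = (p i * A i - B i) + (if i = x then (s - p i) * A i else 0) := by
    intro i _
    rcases eq_or_ne i x with rfl | hix
    · simp only [update_self, if_true]; ring
    · simp only [update_of_ne hix, hix, if_false, add_zero]
  rw [sum_congr rfl h, sum_add_distrib, sum_ite_eq']
  simp

/-- **`p_x`-variation of the generator.** If `v` is invariant along the `p_x`-lines then moving `p_x` to `s`
changes `L v` only through the transport term: `L v (q, p[x ↦ s]) = L v (q, p) + (s - p_x) ∂_{q_x} v (q, p)`
(the force term and the bath terms at `x` vanish with `∂_{p_x} v`). -/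
theorem generator_pVar (P : OscillatorChain) (hU : Differentiable ℝ P.U) (hV : Differentiable ℝ P.V)
    (T_L T_R : ℝ) {v : PhaseSpace N → ℝ} {x : Fin N} (hInv : ∀ z s, v (z.1, update z.2 x s) = v z)
    (z : PhaseSpace N) (s : ℝ) :
    P.generator N T_L T_R v (z.1, update z.2 x s) =
      P.generator N T_L T_R v z + (s - z.2 x) * partialQ x v z := by
  have hQ : ∀ i, partialQ i v (z.1, update z.2 x s) = partialQ i v z := fun i => partialQ_of_pInv hInv i z s
  have hP : ∀ i, partialP i v (z.1, update z.2 x s) = partialP i v z := fun i => partialP_of_pInv hInv i z s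
  have hPP : ∀ i, partialP i (partialP i v) (z.1, update z.2 x s) = partialP i (partialP i v) z :=
    fun i => partialP_of_pInv (f := partialP i v) (fun z' s' => partialP_of_pInv hInv i z' s') i z s
  have hH : ∀ i, partialQ i (P.hamiltonian N) (z.1, update z.2 x s) = partialQ i (P.hamiltonian N) z :=
    fun i => partialQ_hamiltonian_indep_p P hU hV i z.1 z.2 _
  have hx0 : partialP x v z = 0 := partialP_self_of_pInv hInv z
  have hupd : ∀ i, update z.2 x s i * partialP i v z = z.2 i * partialP i v z := by
    intro i
    by_cases hix : i = x
    · subst hix; rw [hx0, mul_zero, mul_zero]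
    · rw [update_of_ne hix]
  have hz : ((z.1, update z.2 x s) : PhaseSpace N).2 = update z.2 x s := rfl
  have hz' : (z : PhaseSpace N) = (z.1, z.2) := rfl
  unfold OscillatorChain.generator
  simp only [hQ, hP, hPP, hH, hupd]
  rw [sum_update_mul z.2 x s (fun i => partialQ i v z) (fun i => partialQ i (P.hamiltonian N) z * partialP i v z)]
  ring

/-- `∂_{q_i} H` is unchanged by moving `q_y` when `i ≥ y + 2`. -/
theorem partialQ_hamiltonian_qVar_far (P : OscillatorChain) (hU : Differentiable ℝ P.U)
    (hV : Differentiable ℝ P.V) {y i : Fin N} (hi : y.val + 2 ≤ i.val) (q p : Fin N → ℝ) (t : ℝ) :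
    partialQ i (P.hamiltonian N) (update q y t, p) = partialQ i (P.hamiltonian N) (q, p) := by
  have hiy : i ≠ y := fun h => by rw [h] at hi; omega
  have hL : leftTerm (deriv P.V) (update q y t) i = leftTerm (deriv P.V) q i := by
    unfold leftTerm
    split_ifs with h0
    · have hne : (⟨i.val - 1, by omega⟩ : Fin N) ≠ y := fun h => by
        have := congrArg Fin.val h; simp only at this; omega
      rw [update_of_ne hne, update_of_ne hiy]
    · rfl
  have hR : rightTerm (deriv P.V) (update q y t) i = rightTerm (deriv P.V) q i := by
    unfold rightTerm
    split_ifs with h1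
    · have hne : (⟨i.val + 1, h1⟩ : Fin N) ≠ y := fun h => by
        have := congrArg Fin.val h; simp only at this; omega
      rw [update_of_ne hne, update_of_ne hiy]
    · rfl
  rw [partialQ_hamiltonian P hU hV i (update q y t, p), partialQ_hamiltonian P hU hV i (q, p)]
  simp only [update_of_ne hiy, hL, hR]

/-- Moving `q_y` changes `∂_{q_{y+1}} H` by `V'(q_{y+1} - t) - V'(q_{y+1} - q_y)`. -/
theorem partialQ_hamiltonian_qVar_succ (P : OscillatorChain) (hU : Differentiable ℝ P.U)
    (hV : Differentiable ℝ P.V) {y : Fin N} (hy : y.val + 1 < N) (q p : Fin N → ℝ) (t : ℝ) :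
    partialQ ⟨y.val + 1, hy⟩ (P.hamiltonian N) (update q y t, p) =
      partialQ ⟨y.val + 1, hy⟩ (P.hamiltonian N) (q, p) +
        (deriv P.V (q ⟨y.val + 1, hy⟩ - t) - deriv P.V (q ⟨y.val + 1, hy⟩ - q y)) := by
  have hxy : (⟨y.val + 1, hy⟩ : Fin N) ≠ y := fun h => by
    have := congrArg Fin.val h; simp only at this; omega
  have hL : ∀ q' : Fin N → ℝ, leftTerm (deriv P.V) q' ⟨y.val + 1, hy⟩ = deriv P.V (q' ⟨y.val + 1, hy⟩ - q' y) := by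
    intro q'
    unfold leftTerm
    rw [dif_pos (show 0 < (⟨y.val + 1, hy⟩ : Fin N).val from Nat.succ_pos _)]
    have : (⟨(⟨y.val + 1, hy⟩ : Fin N).val - 1, by simp only; omega⟩ : Fin N) = y := Fin.ext (by simp)
    rw [this]
  have hR : rightTerm (deriv P.V) (update q y t) ⟨y.val + 1, hy⟩ = rightTerm (deriv P.V) q ⟨y.val + 1, hy⟩ := by
    unfold rightTerm
    split_ifs with h1
    · have hne : (⟨(⟨y.val + 1, hy⟩ : Fin N).val + 1, h1⟩ : Fin N) ≠ y := fun h => by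
        have := congrArg Fin.val h; simp only at this; omega
      rw [update_of_ne hne, update_of_ne hxy]
    · rfl
  rw [partialQ_hamiltonian P hU hV _ (update q y t, p), partialQ_hamiltonian P hU hV _ (q, p)]
  simp only [hL, hR, update_self, update_of_ne hxy]
  ring

/-- A sum with one corrected term. -/
theorem sum_sub_add_ite (a b : Fin N → ℝ) (x : Fin N) (c : ℝ) :
    (∑ i, (a i - (b i + if i = x then c else 0))) = (∑ i, (a i - b i)) - c := by
  have h : ∀ i ∈ (univ : Finset (Fin N)),
      a i - (b i + if i = x then c else 0) = (a i - b i) - (if i = x then c else 0) := by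
    intro i _; ring
  rw [sum_congr rfl h, sum_sub_distrib, sum_ite_eq']
  simp

/-- **`q_y`-variation of the generator.** If `v` is invariant along the `q_y`-lines and `∂_{p_i} v ≡ 0` for all
`i ≤ y`, then moving `q_y` to `t` changes `L v` only through the force on site `y + 1`:
`L v (q[y ↦ t], p) = L v (q, p) - (V'(q_{y+1} - t) - V'(q_{y+1} - q_y)) ∂_{p_{y+1}} v (q, p)`. -/
theorem generator_qVar (P : OscillatorChain) (hU : Differentiable ℝ P.U) (hV : Differentiable ℝ P.V)
    (T_L T_R : ℝ) {v : PhaseSpace N → ℝ} {y : Fin N} (hy : y.val + 1 < N)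
    (hInv : ∀ z s, v (update z.1 y s, z.2) = v z) (hPy : ∀ i : Fin N, i.val ≤ y.val → ∀ z, partialP i v z = 0)
    (z : PhaseSpace N) (t : ℝ) :
    P.generator N T_L T_R v (update z.1 y t, z.2) =
      P.generator N T_L T_R v z -
        (deriv P.V (z.1 ⟨y.val + 1, hy⟩ - t) - deriv P.V (z.1 ⟨y.val + 1, hy⟩ - z.1 y)) *
          partialP ⟨y.val + 1, hy⟩ v z := by
  have hQ : ∀ i, partialQ i v (update z.1 y t, z.2) = partialQ i v z := fun i => partialQ_of_qInv hInv i z t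
  have hP : ∀ i, partialP i v (update z.1 y t, z.2) = partialP i v z := fun i => partialP_of_qInv hInv i z t
  have hPP : ∀ i, partialP i (partialP i v) (update z.1 y t, z.2) = partialP i (partialP i v) z :=
    fun i => partialP_of_qInv (f := partialP i v) (fun z' s' => partialP_of_qInv hInv i z' s') i z t
  -- the force terms
  have hF : ∀ i, partialQ i (P.hamiltonian N) (update z.1 y t, z.2) * partialP i v z =
      partialQ i (P.hamiltonian N) z * partialP i v z +
        (if i = ⟨y.val + 1, hy⟩ then (deriv P.V (z.1 ⟨y.val + 1, hy⟩ - t) -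
          deriv P.V (z.1 ⟨y.val + 1, hy⟩ - z.1 y)) * partialP ⟨y.val + 1, hy⟩ v z else 0) := by
    intro i
    by_cases hix : i = ⟨y.val + 1, hy⟩
    · subst hix
      rw [if_pos rfl, partialQ_hamiltonian_qVar_succ P hU hV hy z.1 z.2 t]
      ring
    · rw [if_neg hix, add_zero]
      by_cases hiy : i.val ≤ y.val
      · rw [hPy i hiy z, mul_zero, mul_zero]
      · have hi2 : y.val + 2 ≤ i.val := by
          have : i.val ≠ y.val + 1 := fun h => hix (Fin.ext h)
          omega
        rw [partialQ_hamiltonian_qVar_far P hU hV hi2 z.1 z.2 t]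
  unfold OscillatorChain.generator
  simp only [hQ, hP, hPP, hF]
  rw [sum_sub_add_ite]
  ring

/-! ### Finite-difference identities for the energy profile `Σ ξ_x e_x` -/

section Energy

variable (P : OscillatorChain) {e : Fin N → PhaseSpace N → ℝ}
  (he : ∀ x z, e x z = z.2 x ^ 2 / 2 + P.U (z.1 x) +
    ∑ j : Fin N, ((if j.val = x.val + 1 then P.V (z.1 j - z.1 x) / 2 else 0) +
      (if x.val = j.val + 1 then P.V (z.1 x - z.1 j) / 2 else 0)))
include he

/-- `p_x`-variation of one split site energy. -/
theorem e_pVar (x' x : Fin N) (z : PhaseSpace N) (s : ℝ) :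
    e x' (z.1, update z.2 x s) = e x' z + (if x' = x then (s ^ 2 - z.2 x ^ 2) / 2 else 0) := by
  rw [he, he]
  by_cases h : x' = x
  · subst h; simp only [update_self, if_true]; ring
  · simp only [update_of_ne h, h, if_false, add_zero]

/-- `p_x`-variation of the profile `Σ ξ_x e_x`. -/
theorem sum_e_pVar (ξ : Fin N → ℝ) (x : Fin N) (z : PhaseSpace N) (s : ℝ) :
    (∑ x', ξ x' * e x' (z.1, update z.2 x s)) = (∑ x', ξ x' * e x' z) + ξ x * ((s ^ 2 - z.2 x ^ 2) / 2) := by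
  simp only [e_pVar P he _ x z s, mul_add, sum_add_distrib, mul_ite, mul_zero, sum_ite_eq', mem_univ, if_true]

/-- A split site energy far from `y` (neither `y` nor a neighbour of `y`) ignores `q_y`. -/
theorem e_qVar_far {y x' : Fin N} (h0 : x' ≠ y) (h1 : x'.val ≠ y.val + 1) (h2 : x'.val + 1 ≠ y.val)
    (z : PhaseSpace N) (t : ℝ) : e x' (update z.1 y t, z.2) = e x' z := by
  rw [he, he]
  simp only [update_of_ne h0]
  congr 1
  refine sum_congr rfl fun j _ => ?_
  congr 1
  · split_ifs with hj
    · have hjy : j ≠ y := fun hh => by rw [hh] at hj; omega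
      rw [update_of_ne hjy]
    · rfl
  · split_ifs with hj
    · have hjy : j ≠ y := fun hh => by rw [hh] at hj; omega
      rw [update_of_ne hjy]
    · rfl

/-- Moving `q_y` changes `e_{y+1}` by `(V(q_{y+1} - t) - V(q_{y+1} - q_y))/2`. -/
theorem e_qVar_succ {y : Fin N} (hy : y.val + 1 < N) (z : PhaseSpace N) (t : ℝ) :
    e ⟨y.val + 1, hy⟩ (update z.1 y t, z.2) =
      e ⟨y.val + 1, hy⟩ z + (P.V (z.1 ⟨y.val + 1, hy⟩ - t) - P.V (z.1 ⟨y.val + 1, hy⟩ - z.1 y)) / 2 := by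
  have hxy : (⟨y.val + 1, hy⟩ : Fin N) ≠ y := fun h => by
    have := congrArg Fin.val h; simp only at this; omega
  rw [he, he]
  simp only [update_of_ne hxy]
  have hsum : (∑ j : Fin N, ((if j.val = (⟨y.val + 1, hy⟩ : Fin N).val + 1 then
        P.V (update z.1 y t j - z.1 ⟨y.val + 1, hy⟩) / 2 else 0) +
        (if (⟨y.val + 1, hy⟩ : Fin N).val = j.val + 1 then P.V (z.1 ⟨y.val + 1, hy⟩ - update z.1 y t j) / 2 else 0))) =
      (∑ j : Fin N, ((if j.val = (⟨y.val + 1, hy⟩ : Fin N).val + 1 then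
        P.V (z.1 j - z.1 ⟨y.val + 1, hy⟩) / 2 else 0) +
        (if (⟨y.val + 1, hy⟩ : Fin N).val = j.val + 1 then P.V (z.1 ⟨y.val + 1, hy⟩ - z.1 j) / 2 else 0))) +
        (P.V (z.1 ⟨y.val + 1, hy⟩ - t) - P.V (z.1 ⟨y.val + 1, hy⟩ - z.1 y)) / 2 := by
    rw [show (P.V (z.1 ⟨y.val + 1, hy⟩ - t) - P.V (z.1 ⟨y.val + 1, hy⟩ - z.1 y)) / 2 =
        ∑ j : Fin N, (if j = y then (P.V (z.1 ⟨y.val + 1, hy⟩ - t) - P.V (z.1 ⟨y.val + 1, hy⟩ - z.1 y)) / 2 else 0)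
        by simp, ← sum_add_distrib]
    refine sum_congr rfl fun j _ => ?_
    by_cases hjy : j = y
    · subst hjy
      have h1 : ¬ (j.val = (⟨j.val + 1, hy⟩ : Fin N).val + 1) := by simp only; omega
      simp only [update_self, h1, if_false, if_true]
      ring
    · have : ¬ ((⟨y.val + 1, hy⟩ : Fin N).val = j.val + 1) := fun hh => hjy (Fin.ext (by simp only at hh; omega))
      simp only [update_of_ne hjy, hjy, if_false, add_zero, this]
  rw [hsum]
  ring

/-- `q_y`-variation of the profile `Σ ξ_x e_x` when `ξ_i = 0` for `i ≤ y`. -/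
theorem sum_e_qVar (ξ : Fin N → ℝ) {y : Fin N} (hy : y.val + 1 < N) (hξ : ∀ i : Fin N, i.val ≤ y.val → ξ i = 0)
    (z : PhaseSpace N) (t : ℝ) :
    (∑ x', ξ x' * e x' (update z.1 y t, z.2)) = (∑ x', ξ x' * e x' z) +
      ξ ⟨y.val + 1, hy⟩ * ((P.V (z.1 ⟨y.val + 1, hy⟩ - t) - P.V (z.1 ⟨y.val + 1, hy⟩ - z.1 y)) / 2) := by
  rw [show ξ ⟨y.val + 1, hy⟩ * ((P.V (z.1 ⟨y.val + 1, hy⟩ - t) - P.V (z.1 ⟨y.val + 1, hy⟩ - z.1 y)) / 2) =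
      ∑ x' : Fin N, (if x' = ⟨y.val + 1, hy⟩ then ξ ⟨y.val + 1, hy⟩ *
        ((P.V (z.1 ⟨y.val + 1, hy⟩ - t) - P.V (z.1 ⟨y.val + 1, hy⟩ - z.1 y)) / 2) else 0) by simp,
    ← sum_add_distrib]
  refine sum_congr rfl fun x' _ => ?_
  by_cases hx : x' = ⟨y.val + 1, hy⟩
  · subst hx
    rw [if_pos rfl, e_qVar_succ P he hy z t]
    ring
  · rw [if_neg hx, add_zero]
    by_cases hle : x'.val ≤ y.val
    · rw [hξ x' hle, zero_mul, zero_mul]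
    · have h2 : y.val + 2 ≤ x'.val := by
        have : x'.val ≠ y.val + 1 := fun h => hx (Fin.ext h)
        omega
      rw [e_qVar_far P he (y := y) (x' := x') (fun h => by rw [h] at h2; omega) (by omega) (by omega) z t]

end Energy

end OrthogonalOhmLine.BracketInduction

open OrthogonalOhmLine.BracketInduction in
/-- Registered helper of stub F3 (`stub_bracketInduction`): the `p_x`-variation of the generator (= `generator_pVar`). -/
theorem helper_bracketInductionGeneratorPVar : ∀ {N : ℕ} (P : Literature.MathematicalPhysics.KineticTheory.HeatConduction.OscillatorChain), Differentiable ℝ P.U → Differentiable ℝ P.V → ∀ (T_L T_R : ℝ) {v : Literature.MathematicalPhysics.KineticTheory.HeatConduction.PhaseSpace N → ℝ} {x : Fin N}, (∀ (z : Literature.MathematicalPhysics.KineticTheory.HeatConduction.PhaseSpace N) (s : ℝ), v (z.1, Function.update z.2 x s) = v z) → ∀ (z : Literature.MathematicalPhysics.KineticTheory.HeatConduction.PhaseSpace N) (s : ℝ), P.generator N T_L T_R v (z.1, Function.update z.2 x s) = P.generator N T_L T_R v z + (s - z.2 x) * Literature.MathematicalPhysics.KineticTheory.HeatConduction.partialQ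 x v z :=
  fun P hU hV T_L T_R _v _x hInv z s => generator_pVar P hU hV T_L T_R hInv z s

end Summit.AtomisticToContinuum.FouriersLaw.Theorems.HonestZwanzig
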